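import Summits.KontsevichZagierPeriods.Zeta5Search.LaiSweepShard

/-!
# `κ₃` sweep certificate — shard file 083 of 127 (shards 581–587 of 889)

HONEST FRAMING. Systematic search; no irrationality claim unless certified. This file only checks,
by `decide +kernel`, shards 581–587 of the order-cell sweep of the `κ₃` point `(74, 2180, 444; δ74)`
(engine `LaiSweepEngine`, soundness `LaiSweepJump/Free/Eval/Shard/Kappa3`; a shard is `⟨regime, n,
p, q, p', q', Lo, Up⟩`: `n` cells from `p/q` to `p'/q'` with integer rate sums in `[Lo, Up]`, `K =
128`, `D = 2^40`). It draws NO conclusion: only the capstone `LaiKappa3SweepCert`, which needs all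
127 shard files, does. Kernel cost of this file ≈ 560 cells × 0.3 s.
-/

namespace Summit.KontsevichZagierPeriods.Zeta5Search.Sweep

set_option maxHeartbeats 100000000 in
/-- Shard 581: 80 cells of regime B from `19/31` to `269/438`.
[cite: Lai2024BallRivoal, §4 Lemma 4.3] -/
theorem shard581 :
    Shard.check 128 (2^40)
      ⟨true, 80, 19, 31, 269, 438, 13026032407346, 17341820684156⟩ = true := by
  decide +kernel

set_option maxHeartbeats 100000000 in
/-- Shard 582: 80 cells of regime B from `269/438` to `261/424`.
[cite: Lai2024BallRivoal, §4 Lemma 4.3] -/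
theorem shard582 :
    Shard.check 128 (2^40)
      ⟨true, 80, 269, 438, 261, 424, 14648843815938, 19523718664075⟩ = true := by
  decide +kernel

set_option maxHeartbeats 100000000 in
/-- Shard 583: 80 cells of regime B from `261/424` to `177/287`.
[cite: Lai2024BallRivoal, §4 Lemma 4.3] -/
theorem shard583 :
    Shard.check 128 (2^40)
      ⟨true, 80, 261, 424, 177, 287, 12017297495413, 16032875569281⟩ = true := by
  decide +kernel

set_option maxHeartbeats 100000000 in
/-- Shard 584: 80 cells of regime B from `177/287` to `241/390`.
[cite: Lai2024BallRivoal, §4 Lemma 4.3] -/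
theorem shard584 :
    Shard.check 128 (2^40)
      ⟨true, 80, 177, 287, 241, 390, 12685221219108, 16940453558837⟩ = true := by
  decide +kernel

set_option maxHeartbeats 100000000 in
/-- Shard 585: 80 cells of regime B from `241/390` to `148/239`.
[cite: Lai2024BallRivoal, §4 Lemma 4.3] -/
theorem shard585 :
    Shard.check 128 (2^40)
      ⟨true, 80, 241, 390, 148, 239, 13431159752863, 17955207645231⟩ = true := by
  decide +kernel

set_option maxHeartbeats 100000000 in
/-- Shard 586: 80 cells of regime B from `148/239` to `85/137`.
[cite: Lai2024BallRivoal, §4 Lemma 4.3] -/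
theorem shard586 :
    Shard.check 128 (2^40)
      ⟨true, 80, 148, 239, 85, 137, 12306460962401, 16468196694502⟩ = true := by
  decide +kernel

set_option maxHeartbeats 100000000 in
/-- Shard 587: 80 cells of regime B from `85/137` to `166/267`.
[cite: Lai2024BallRivoal, §4 Lemma 4.3] -/
theorem shard587 :
    Shard.check 128 (2^40)
      ⟨true, 80, 85, 137, 166, 267, 13259245273189, 17761222378085⟩ = true := by
  decide +kernel

/-- The checked shards of this file, in order. [folklore] -/
def shards083 : List (CheckedShard 128 (2^40)) :=
  [⟨_, shard581⟩, ⟨_, shard582⟩, ⟨_, shard583⟩, ⟨_, shard584⟩, ⟨_, shard585⟩,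
    ⟨_, shard586⟩, ⟨_, shard587⟩]

end Summit.KontsevichZagierPeriods.Zeta5Search.Sweep
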